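/-
Copyright: statement-level skeleton of a published paper (lit-balaban cell, Phase-2 proof seat p37 gen 109). No claims beyond
what the kernel checks below.
-/
import Mathlib
import Literature.MathematicalPhysics.QuantumFieldTheory.Balaban1983to89.B3OnePIChainUnglue
import Literature.MathematicalPhysics.QuantumFieldTheory.Balaban1983to89.B3GraphIsoAmplitude

/-!
# B3 — T. Bałaban, *(Higgs)₂,₃ quantum fields in a finite volume. III. Renormalization*, CMP **88** (1983) 411–445
[Balaban1983Higgs3], pp. 415–416 [PDF 5–6], (1.21): **THE VALUES OF THE REGROUPED TERMS OF (1.21) THROUGH REPRESENTATIVES — for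
any regrouping datum (letters and connected two-point objects with chosen representative graphs, a bijection object ≃ string of
letters, and an isomorphism of each object's representative onto the chain of its letters' representatives) the value
C₀·K(representative)·C₀ of an object is the chain value of its string of letters, and the generating series of these values
satisfies r15's resummed (1.21)** — p37's values (`B3OnePIChainAmplitude.chainValue`, `eq121_chainValue`) composed with an
abstract regrouping, the two glued by the isomorphism invariance of the amputated kernel (`B3GraphIsoAmplitude.kernel_pull`);
p32's isomorphism classes (`B3OnePIChainClasses.classEquiv`, `rep`, `repIso`) are the instance of record

statement-level skeleton of published theorems with citation tags; proofs where landed; nothing here is a claim about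
the Yang–Mills mass gap

PDF held: `paper:balaban1983-higgs-2-3-quantum-fields-finite-volume` (journal page = PDF page + 410); p. 416 (1.21) as re-read by
p32 / p37 for the files this one composes.

CITATION HEADER (lean-in-tree rule).  lit-balaban TYPED SKELETON (HOME `run/shared/lean/pub/lit-balaban/`), PHASE 2, seat p37
gen 109 (unit `lit-balaban-p37`; TAKING (V), HOME/STATUS.md 2026-08-23T19:13Z, addendum of TAKING (L) 18:03:45Z; free-target
protocol G.5-34(d)), row **B3.Eq1.19-1.22** of `HOME/lit-balaban-r15/ROWS-B3.md` (fold owner r15, referee ref-4; OPTIONAL located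
member of the (1.21) cell, zero head weight).  THE ITEM: p32 gen 44's `B3OnePIChainClasses` HONEST SCOPE (ii): *"(1.21) for the
series indexed by `UnglueableClass` itself — needs a dressing of the chosen representatives `rep` and the invariance of
`Dressing.kernel` under `TwoLegGraphIso`"*.  The invariance is p37's `B3GraphIsoAmplitude.kernel_pull` (p370289); this file does
the composition for an ABSTRACT regrouping datum `Regrouping` (so that the values side does not depend on how the classes and their
representatives are chosen); the instance `Letter := LetterClass`, `Obj := UnglueableClass`, `decomp := classEquiv`,
`iso := repIso ∘ …` is the successor file `B3OnePIChainClassValues` (once `B3OnePIChainClasses` is in the tree).  CONSUMES BY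
NAME: p37's `B3OnePIChainGlue.{TwoLegGraph, chain}`, `B3OnePIChainAmplitude.{Dressing, Dressed, Dressing.kernel, chainDressing,
chainValue, chainOrder, chainValue_eq_chainAmp, chainOrder_eq_chainDeg, chainIndexEquiv}` (p368132), `B3GraphIsoAmplitude.{pullDressing,
kernel_pull}` (p370289); p32's `B3GraphIso.TwoLegGraphIso` (+ `trans`), `B3OnePIChainUnglue.isoOfEq` (p368768),
`B3Eq121OnePIChains.{sigmaSeries, greenSeries, chainAmp, chainDeg}`, `B3Eq121OnePIChainsLetters.{sigmaSeries_eq_greenSeries_of_equiv,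
eq121_sigmaSeries_of_equiv}`; r15's `B3Sect1TwoPoint.Eq121`.  Nothing re-declared.

THE PRINTED TEXT (verbatim), p. 416 [PDF 6]: *"G^ε = Σ_{n=0}^∞ C₀^ε[(−δm² + Σ^ε + ∂^{ε*}Σ₁^ε + Σ₁^{ε*}∂^ε + ∂^{ε*}Σ₂^ε∂^ε)C₀^ε]ⁿ,
(1.21) where C₀^ε = (−Δ₀^ε + m²)^{−1} and Σ^ε, Σ₁^ε, Σ₂^ε are given by amputated, one-particle-irreducible graphs of the expansion of
G^ε."*  p. 415 [PDF 5]: *"Now a graph for us is a collection of internal lines, external legs, and vertices connected in the usual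
sense."*

KIND «(ours)» (G.5-54).  Print sums (1.21) over graphs *"in the usual sense"*; on p18's labelled carrier a regrouped term is an
index with a chosen representative graph, and it is given a VALUE through that representative.  That this value is the chain
value of its letters and that the regrouping (1.21) holds for the index-level series is OUR plumbing (p32's bijection shape +
p37's values + the invariance of the kernel); print provenance is claimed only for (1.21) itself.

WHAT IS TYPED / PROVED (definitions with bodies + theorems; no `Prop` fact, no `sorry`; standard axioms).
* **`Regrouping nbar`** (the datum: `Letter`, `Obj`, representatives `repL` / `repO`, `decomp : Obj ≃ Letter × List Letter`,
  `iso y : repO y ≅ chain (repL (decomp y).1) ((decomp y).2.map repL)`).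
* **`LetterDressing`** (a dressing of every letter's representative), `letterFamily`, **`repChainDressed`** (the chain of the
  dressed letter representatives of a string), `repChainDressed_fst`, **`objIsoChain`** (the object's representative ≅ that chain:
  `iso` followed by p32's `isoOfEq`), **`objDressing`** (THE DRESSING OF AN OBJECT: the chain dressing read on the representative
  through that isomorphism — p37's `pullDressing`).
* **`objValue`** (`C₀` for the bare line, `C₀·K(repO y, objDressing y)·C₀` for an object), **`objValue_eq_chainValue`** (THE STEP
  THAT USES `kernel_pull`), `objIndexEquiv : Option Obj ≃ List Letter` (the shape BRICK 2 consumes), `objValue_eq_chainAmp`,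
  `objOrder`, `objOrder_eq_chainDeg`, **`sigmaSeries_objValue_eq_greenSeries`**, **`eq121_objValue`** (r15's `Eq121` for the
  object-indexed series, `X` = the series of the letters' amputated kernels), `kernel_rep_eq_of_iso` (another representative,
  dressed through an isomorphism, has the same kernel).
HONEST SCOPE.  (a) The dressing of the letters is a PARAMETER (one dressing per letter representative); that the physical dressing
of an arbitrary representative is the transported one is `B3GraphIsoAmplitude`'s HONEST SCOPE (a).  (b) The regrouping datum is
abstract here; p32's classes instantiate it (successor file) with the honest scope of `B3OnePIChainClasses` (no `−δm²` letter, no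
sorting of the letters into `Σ^ε, ∂^{ε*}Σ₁^ε, Σ₁^{ε*}∂^ε, ∂^{ε*}Σ₂^ε∂^ε`); no symmetry factors (p. 416: *"Here we did not write, and
we will not write in the future, combinatoric factors"*), no finiteness of the letters of given order beyond the hypothesis
`hfin`, nothing analytic.  Definitions with bodies + theorems; no `Prop` fact, no `sorry`; standard axioms.  Unit
`lit-balaban-p37` gen 109 (literature-prover-lit-balaban-p37-g109-0), HOME `run/shared/lean/pub/lit-balaban/`, 2026-08-23.
-/

open Finset
open scoped BigOperators

namespace Literature.MathematicalPhysics.QuantumFieldTheory.Balaban1983to89.B3ChainRegroupingValues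

open B3Prop1 B3Cor23Concrete B3GraphAmplitude B3GraphIso B3OnePIChainGlue B3OnePIChainAmplitude B3GraphIsoAmplitude
  B3OnePIChainUnglue

noncomputable section

variable {nbar : ℕ}

/-! ## §1 The regrouping datum -/

variable (nbar) in
/-- **A REGROUPING DATUM for (1.21) on the model** («(ours)»): an index `Letter` of the letters of the insertion with a
representative two-leg graph for each, an index `Obj` of the regrouped connected two-point objects (other than the bare line) with
representatives, the bijection *object ≃ (head letter, tail letters)* behind the regrouping, and for every object an isomorphism of
its representative onto the chain of the representatives of its letters — the shape of p32's `B3OnePIChainClasses.classEquiv` with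
`rep` / `repIso` (isomorphism classes of unglueable insertions ≃ strings of letter classes), which is the instance of record.
[cite: Balaban1983Higgs3, (1.21) p.416] [cite: Balaban1983Higgs3, p.415] -/
structure Regrouping where
  /-- the index of the letters -/
  Letter : Type
  /-- the index of the regrouped connected two-point objects -/
  Obj : Type
  /-- a representative insertion of every letter -/
  repL : Letter → TwoLegGraph nbar
  /-- a representative insertion of every object -/
  repO : Obj → TwoLegGraph nbar
  /-- the bijection object ≃ (head letter, tail letters) -/
  decomp : Obj ≃ Letter × List Letter
  /-- the representative of an object is isomorphic to the chain of the representatives of its letters -/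
  iso : ∀ y : Obj, TwoLegGraphIso (repO y) (chain (repL (decomp y).1) ((decomp y).2.map repL))

variable (R : Regrouping nbar) {SF VF OF IS IV IO : Type*}

/-! ## §2 Dressing the objects through their representatives -/

variable (SF VF OF IS IV IO) in
/-- **A LETTER DRESSING**: a dressing (vertex rules, (1.18) pairing, line kernels, external data of the non-channel legs) of the
representative of every letter — the data that make the letters of (1.21) (the amputated 1PI kernels Σ) numbers.
[cite: Balaban1983Higgs3, (1.21) p.416] [cite: Balaban1983Higgs3, p.420] -/
abbrev LetterDressing : Type _ := (c : R.Letter) → Dressing SF VF OF IS IV IO (R.repL c)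

/-- The dressed letter representatives as a family of dressed insertions (the shape p37's `chainValue` takes).
[cite: Balaban1983Higgs3, (1.21) p.416] -/
def letterFamily (Dc : LetterDressing R SF VF OF IS IV IO) : R.Letter → Dressed SF VF OF IS IV IO nbar :=
  fun c => ⟨R.repL c, Dc c⟩

/-- **The chain of the dressed letter representatives of a string** (head letter, tail letters), as a dressed insertion: p37's
`chain` of the representatives with the `chainDressing` (the letters' dressings joined by the propagator `C` on every new line).
[cite: Balaban1983Higgs3, (1.21) p.416] -/
def repChainDressed (C : IS → IS → ℝ) (Dc : LetterDressing R SF VF OF IS IV IO) (x : R.Letter × List R.Letter) :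
    Dressed SF VF OF IS IV IO nbar :=
  ⟨chain (R.repL x.1) ((x.2.map (letterFamily R Dc)).map Sigma.fst), chainDressing C (R.repL x.1) (Dc x.1) (x.2.map (letterFamily R Dc))⟩

/-- kernel: the underlying graph of the chain of dressed representatives is the chain of the representatives.
[cite: Balaban1983Higgs3, (1.21) p.416] -/
theorem repChainDressed_fst (C : IS → IS → ℝ) (Dc : LetterDressing R SF VF OF IS IV IO) (x : R.Letter × List R.Letter) :
    (repChainDressed R C Dc x).1 = chain (R.repL x.1) (x.2.map R.repL) := by
  show chain (R.repL x.1) ((x.2.map (letterFamily R Dc)).map Sigma.fst) = _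
  rw [List.map_map]
  rfl

/-- **The representative of an object is isomorphic to the chain of its dressed letter representatives** (the datum's `iso`,
followed by p32's `isoOfEq` along `repChainDressed_fst`). [cite: Balaban1983Higgs3, (1.21) p.416] [cite: Balaban1983Higgs3, p.415] -/
def objIsoChain (C : IS → IS → ℝ) (Dc : LetterDressing R SF VF OF IS IV IO) (y : R.Obj) :
    TwoLegGraphIso (R.repO y) (repChainDressed R C Dc (R.decomp y)).1 :=
  (R.iso y).trans (isoOfEq (repChainDressed_fst R C Dc (R.decomp y)).symm)

/-- **THE DRESSING OF AN OBJECT**: on its representative `repO y`, the chain dressing of the dressed representatives of its letters,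
read through the isomorphism `repO y ≅ chain of representatives` (p37's `pullDressing`). [cite: Balaban1983Higgs3, (1.21) p.416]
[cite: Balaban1983Higgs3, p.420] -/
def objDressing (C : IS → IS → ℝ) (Dc : LetterDressing R SF VF OF IS IV IO) (y : R.Obj) : Dressing SF VF OF IS IV IO (R.repO y) :=
  pullDressing (objIsoChain R C Dc y) (repChainDressed R C Dc (R.decomp y)).2

/-! ## §3 The values of the regrouped terms and (1.21) for their series -/

variable [Fintype IS] [Fintype IV] [Fintype IO] [DecidableEq IS] (bS : IS → SF) (bV : IV → VF) (bO : IO → OF) (C : IS → IS → ℝ)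
  (Dc : LetterDressing R SF VF OF IS IV IO)

/-- **THE VALUE OF A REGROUPED TERM OF (1.21)**: `C₀` for the bare line (the `n = 0` term), and for an object `y`
`C₀ · K(repO y) · C₀` — the free propagators on the two external legs of the amputated kernel of its dressed representative.
[cite: Balaban1983Higgs3, (1.21) p.416] -/
def objValue : Option R.Obj → Matrix IS IS ℝ
  | none => Matrix.of C
  | some y => Matrix.of C * (objDressing R C Dc y).kernel bS bV bO * Matrix.of C

/-- **THE VALUE OF AN OBJECT IS p37's CHAIN VALUE AT ITS STRING OF LETTERS** — the step that uses the isomorphism invariance of the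
amputated kernel (`B3GraphIsoAmplitude.kernel_pull`): the kernel of the representative with the transported chain dressing is the
kernel of the chain of representatives. [cite: Balaban1983Higgs3, (1.21) p.416] [cite: Balaban1983Higgs3, p.415] -/
theorem objValue_eq_chainValue (g : Option R.Obj) :
    objValue R bS bV bO C Dc g = chainValue bS bV bO C (letterFamily R Dc) (g.map R.decomp) := by
  rcases g with _ | y
  · rfl
  · change Matrix.of C * (pullDressing (objIsoChain R C Dc y) (repChainDressed R C Dc (R.decomp y)).2).kernel bS bV bO *
        Matrix.of C = chainValue bS bV bO C (letterFamily R Dc) (some (R.decomp y))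
    rw [kernel_pull]
    generalize R.decomp y = x
    obtain ⟨c, cs⟩ := x
    rfl

/-- **The index bijection in the shape BRICK 2 consumes** (`γ ≃ List ι` of `B3Eq121OnePIChainsLetters.sigmaSeries_eq_greenSeries_of_equiv`):
the bare line ↦ `[]`, an object ↦ the string of its letters (for p32's classes: `B3OnePIChainClasses.classEquivList`).
[cite: Balaban1983Higgs3, (1.21) p.416] -/
def objIndexEquiv : Option R.Obj ≃ List R.Letter :=
  (Equiv.optionCongr R.decomp).trans (chainIndexEquiv R.Letter)

/-- kernel: the value of a regrouped term is p32's chain value `chainAmp C₀ K` of its string of letters.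
[cite: Balaban1983Higgs3, (1.21) p.416] -/
theorem objValue_eq_chainAmp (g : Option R.Obj) :
    objValue R bS bV bO C Dc g =
      B3Eq121OnePIChains.chainAmp (Matrix.of C) (fun c => (Dc c).kernel bS bV bO) (objIndexEquiv R g) :=
  calc objValue R bS bV bO C Dc g = chainValue bS bV bO C (letterFamily R Dc) (g.map R.decomp) :=
        objValue_eq_chainValue R bS bV bO C Dc g
    _ = B3Eq121OnePIChains.chainAmp (Matrix.of C) (fun c => (Dc c).kernel bS bV bO) (objIndexEquiv R g) :=
        chainValue_eq_chainAmp bS bV bO C (letterFamily R Dc) (g.map R.decomp)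

variable {σ : Type*} (deg : R.Letter → σ →₀ ℕ)

/-- The ORDER of a regrouped term in the couplings: the sum of the orders of its letters. [cite: Balaban1983Higgs3, (1.21) p.416] -/
def objOrder (g : Option R.Obj) : σ →₀ ℕ :=
  chainOrder deg (g.map R.decomp)

/-- kernel: the order of a regrouped term is p32's chain order of its string of letters. [cite: Balaban1983Higgs3, (1.21) p.416] -/
theorem objOrder_eq_chainDeg (g : Option R.Obj) :
    objOrder R deg g = B3Eq121OnePIChains.chainDeg deg (objIndexEquiv R g) :=
  chainOrder_eq_chainDeg deg (g.map R.decomp)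

/-- **(1.21) FOR THE REGROUPED SERIES, I**: the generating series `Σ_g e^{order g}·value g` over the bare line and the objects IS
p32's chain series `greenSeries C₀ K deg` of the letters' amputated kernels `K c = (Dc c).kernel` — p32's transport theorem along
`objIndexEquiv`. [cite: Balaban1983Higgs3, (1.21) p.416] -/
theorem sigmaSeries_objValue_eq_greenSeries :
    B3Eq121OnePIChains.sigmaSeries (objValue R bS bV bO C Dc) (objOrder R deg) =
      B3Eq121OnePIChains.greenSeries (Matrix.of C) (fun c => (Dc c).kernel bS bV bO) deg :=
  B3Eq121OnePIChainsLetters.sigmaSeries_eq_greenSeries_of_equiv _ _ _ _ _ (objIndexEquiv R)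
    (objValue_eq_chainAmp R bS bV bO C Dc) (objOrder_eq_chainDeg R deg)

/-- **(1.21) FOR THE REGROUPED SERIES, II**: if every letter has positive order and each order carries finitely many letters,
r15's resummed (1.21) `Eq121 G (C C₀) X` HOLDS for `G` = the series of the values of the regrouped terms (computed on their
representatives) and `X` = the series of the letters' amputated kernels — print's sum over graphs *"in the usual sense"*.
[cite: Balaban1983Higgs3, (1.21) p.416] [cite: Balaban1983Higgs3, p.415] -/
theorem eq121_objValue (hne : ∀ c, deg c ≠ 0) (hfin : ∀ d, {c | deg c = d}.Finite) :
    B3Sect1TwoPoint.Eq121 (B3Eq121OnePIChains.sigmaSeries (objValue R bS bV bO C Dc) (objOrder R deg))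
      (MvPowerSeries.C (Matrix.of C)) (B3Eq121OnePIChains.sigmaSeries (fun c => (Dc c).kernel bS bV bO) deg) :=
  B3Eq121OnePIChainsLetters.eq121_sigmaSeries_of_equiv _ _ _ _ _ (objIndexEquiv R)
    (objValue_eq_chainAmp R bS bV bO C Dc) (objOrder_eq_chainDeg R deg) hne hfin

/-- **ANY REPRESENTATIVE GIVES THE SAME KERNEL**: an insertion `T` isomorphic to the chosen representative of an object, dressed
through the isomorphism, has the same amputated kernel (`kernel_pull`) — the value of a regrouped term does not depend on the
representative. [cite: Balaban1983Higgs3, p.415] [cite: Balaban1983Higgs3, (1.21) p.416] -/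
theorem kernel_rep_eq_of_iso {T : TwoLegGraph nbar} (y : R.Obj) (e : TwoLegGraphIso T (R.repO y)) :
    (pullDressing e (objDressing R C Dc y)).kernel bS bV bO = (objDressing R C Dc y).kernel bS bV bO :=
  kernel_pull bS bV bO e _

end

end Literature.MathematicalPhysics.QuantumFieldTheory.Balaban1983to89.B3ChainRegroupingValues
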